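import Summits.QuantumFields.BalabanUV.Beta.SymmetrisedAxialPotential

/-!
# `BalabanUV.Beta.SymmetrisedAxialGauge` — binder row D1, RULING R-D1-g25-1 step S1d: THE SYMMETRISED ROOTED AXIAL GAUGE
# `Σ_σ A(Γ^σ_{r(y),x}) = 0`, ITS PROJECTOR `A ↦ A − grad((d!)⁻¹·symTreeGaugeAt ρ A)`, attainability, rigidity, idempotence, «the two points of view
# coincide» on gauge-fixed fields, and THE PERMUTATION COVARIANCE OF THE PROJECTOR at the centred root (the comb's `RootedComb.axProjAt` has
# reflections only)

HONEST FRAMING (cell contract, verbatim): «discharging `BetaPertH` makes Bałaban's UV stability UNCONDITIONAL — a real constructive-QFT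
result; it is NOT the continuum limit and NOT the Clay problem.»  THIS MODULE DISCHARGES NOTHING of `BetaPertH` ∕ row D1: [folklore] finite sums
on `ℤ^d` (Form level).  0 sorry, 0 `def … : Prop` carrying a citation (the one `Prop`-valued def is OUR gauge condition on OUR typed object, no
printed statement), nothing cited as a fact; quotations are OBJECT LOCATORS.

WHAT AND WHY.  The re-based literal «JsB12Sym» (R-D1-g25-1) needs a gauge slice compatible with the (0.4)-symmetrised averaging.  [Balaban1987RG1]
fixes the residual gauge group `{u : u(y) = 1, y ∈ T^{(1)}}` with the M-averaged contour variables (0.11) `U(y,x) = M({U(Γ)}_{Γ∈G(y,x)})` through the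
exponential weight (0.14) and the Faddeev–Popov identity (0.15)–(0.16) p.254–255 («the integral over u is equal to 1»); by (0.8) p.253 the
linearisation of `(1∕i) log U(y,x)` is the MEAN of `A(Γ)` over `G(y,x)` — [analysis, R-D1-g25-1 (4)(R1)] `= (1∕d!)·symAxial A y x` of S1.  At the
linearised level any unit-normalised insertion fixing the same residual group gives the same `Tρ` (FP), so the cell may use the SHARP condition
`symAxial A (r(y)) x = 0` for all `x ∈ B(y)` — typed here as `SymAxialGaugeAt ρ A L` — in place of the Gaussian weight (0.14) ([Balaban1987RG1]
p.254: δ-functions of `U(y,x)` are «inconvenient» NONLINEARLY; at linear order they are linear constraints).  PROVED ([folklore]): the symmetrised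
tree gauge of an exact form (`symTreeGaugeAt_grad`), vanishing at roots, block form; ATTAINABILITY `symAxialGaugeAt_symAxProjAt` (the projector
`symAxProjAt ρ L A := A − grad ((d!)⁻¹ • symTreeGaugeAt ρ A L)` lands in the slice), RIGIDITY (`symAxialGaugeAt_rigid`: a gauge transformation
between two gauge-fixed fields is constant on blocks — a COMPLETE fixing of the residual group), `symTreeGaugeAt_eq_zero_of_symAxialGaugeAt`,
IDEMPOTENCE, `symAxProjAt_eq_self_of_symAxialGaugeAt`; ON GAUGE-FIXED FIELDS THE SYMMETRISED AVERAGING IS `d!`× THE STRAIGHT BLOCK-CONTOUR SUM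
(`symLinAvgAt_eq_of_symAxialGaugeAt`, cf. `AveragingContoursRooted.linAvgAt_eq_straightSum_of_axialGaugeAt`) and is blind to the projector
(`symLinAvgAt_symAxProjAt`); and **`symAxProjAt_ctr_P1 : symAxProjAt (ctr d L) L (P1 π A) = P1 π (symAxProjAt (ctr d L) L A)`** — the projector
COMMUTES with every axis permutation (S1 `symTreeGaugeAt_ctr_P1` + `P1_grad`), which the comb projector does not (`CombPermutationWitness`).
NOT HERE: kernels (`axEc`-type coordinate projectors for the symmetrised slice), the block-mean variant, reflections, estimates, any identification
with Bałaban's minimisers ∕ propagators ∕ β.  NOT D1, NOT BetaPertH, NOT continuum, NOT Clay.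
CHART (RULING R-D1-g25-4): chart (II) — the FIXED κ = 0 slice `ker G_sym` with the block-orthogonal `symE`; the slice-exchange row hSX
(`R_SX`, an3-g46 THEOREM R, `b2b-balaban-beta-an3/gen46/FP-SYM.v1.md`) is a SEPARATE displayed binder of the literal and is NOT in this file.
HONEST DEPENDENCY (verbatim): «continuum YM on T⁴ ⇐ BetaPertH ∧ nine spine estimates (0/9 proved); BetaPertH ⇐ (D1) ∧ (D4) ∧ CAP+tail;
G-an2-4 gates asym, D1 and NE2/3/4.»  ABSOLUTE RULE (cell, verbatim): «No internally-minted statement may enter as a cited fact. Every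
hypothesis is either kernel-proved in this package or a verbatim quotation of a PUBLISHED theorem with page reference.»
Unit `b2b-balaban-beta-an2` gen 25 (row-D1 owner), 2026-08-21.
-/

namespace Summit.QuantumFields.BalabanUV.Beta.SymmetrisedAxialGauge

noncomputable section

open Finset
open scoped BigOperators Nat
open Literature.MathematicalPhysics.QuantumFieldTheory.Balaban1983to89.Beta
open AffineAveraging (Form0 Form1 Site unitVec dz box toSite contourSum)
open AveragingContours (grad shift axial blk blk_block blk_add_off off off_mem_box)
open AveragingContoursRooted (ctr ctrOff ctrOff_mem_box)
open Summit.QuantumFields.BalabanUV.Beta.KernelPermutation (psite psite_apply)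
open Summit.QuantumFields.BalabanUV.Beta.ResolventPermutation (P0 P1 P0_apply P1_apply)
open Summit.QuantumFields.BalabanUV.Beta.SymmetrisedAxialPotential

variable {d : ℕ}

/-! ## §1 The symmetrised tree gauge: exact forms, roots, blocks -/

/-- [folklore] `d! ≠ 0` in `ℝ`. -/
theorem factorial_ne_zero_real : (d ! : ℝ) ≠ 0 := Nat.cast_ne_zero.mpr (Nat.factorial_ne_zero d)

/-- [folklore] The symmetrised tree gauge at a block point, in-block root offset `ρ = toSite r`: `= symAxial A (L·y + r) (L·y + b)`. -/
theorem symTreeGaugeAt_block {L : ℕ} (r : Fin d → ℕ) (A : Form1 d ℝ) (y : Site d) {b : Fin d → ℕ} (hb : b ∈ box d L) :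
    symTreeGaugeAt (toSite r) A L ((L : ℤ) • y + toSite b) = symAxial A ((L : ℤ) • y + toSite r) ((L : ℤ) • y + toSite b) := by
  rw [symTreeGaugeAt, blk_block y hb]

/-- [folklore] The symmetrised tree gauge VANISHES AT THE ROOTS (in-block root offset). -/
theorem symTreeGaugeAt_root {L : ℕ} {r : Fin d → ℕ} (hr : r ∈ box d L) (A : Form1 d ℝ) (y : Site d) :
    symTreeGaugeAt (toSite r) A L ((L : ℤ) • y + toSite r) = 0 := by
  rw [symTreeGaugeAt_block r A y hr, symAxial_self]

/-- [folklore] **EXACT FORMS**: `symTreeGaugeAt ρ (grad f) L x = d!·(f x − f (root of the block of x))`. -/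
theorem symTreeGaugeAt_grad (ρ : Site d) (f : Form0 d ℝ) (L : ℕ) (x : Site d) :
    symTreeGaugeAt ρ (grad f) L x = (d ! : ℝ) * (f x - f ((L : ℤ) • blk L x + ρ)) := by
  rw [symTreeGaugeAt, symAxial_grad]

/-- [folklore] Linearity (differences). -/
theorem symTreeGaugeAt_sub (ρ : Site d) (A A' : Form1 d ℝ) (L : ℕ) (x : Site d) :
    symTreeGaugeAt ρ (A - A') L x = symTreeGaugeAt ρ A L x - symTreeGaugeAt ρ A' L x := by
  simp only [symTreeGaugeAt, symAxial_sub]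

/-! ## §2 The symmetrised rooted axial gauge and its projector -/

/-- [folklore] [our object] **THE SYMMETRISED ROOTED AXIAL GAUGE**: `Σ_σ A(Γ^σ_{L·y+ρ, x}) = 0` for every block `y` and every `x ∈ B(y)` — the sharp, linearised
form of the gauge fixing by the averaged contour variables [Balaban1987RG1] (0.11) (header); cf. the single-comb `AveragingContoursRooted.AxialGaugeAt`. -/
def SymAxialGaugeAt (ρ : Site d) (A : Form1 d ℝ) (L : ℕ) : Prop :=
  ∀ (y : Site d) (b : Fin d → ℕ), b ∈ box d L → symAxial A ((L : ℤ) • y + ρ) ((L : ℤ) • y + toSite b) = 0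

/-- [our object] **THE SYMMETRISED AXIAL PROJECTOR** `A ↦ A − grad ((d!)⁻¹ · symTreeGaugeAt ρ A L)` (cf. `RootedComb.axProjAt`). -/
def symAxProjAt (ρ : Site d) (L : ℕ) (A : Form1 d ℝ) : Form1 d ℝ :=
  A - grad (fun x => (d ! : ℝ)⁻¹ * symTreeGaugeAt ρ A L x)

/-- [folklore] Pointwise form of the projector. -/
theorem symAxProjAt_apply (ρ : Site d) (L : ℕ) (A : Form1 d ℝ) (κ : Fin d) (x : Site d) :
    symAxProjAt ρ L A κ x = A κ x - (d ! : ℝ)⁻¹ * (symTreeGaugeAt ρ A L (x + unitVec κ) - symTreeGaugeAt ρ A L x) := by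
  simp only [symAxProjAt, Pi.sub_apply, grad, mul_sub]

/-- [folklore] In the symmetrised axial gauge the symmetrised block potential `SymLamAt` vanishes. -/
theorem SymLamAt_eq_zero_of_symAxialGaugeAt {ρ : Site d} {A : Form1 d ℝ} {L : ℕ} (hA : SymAxialGaugeAt ρ A L) (y : Site d) :
    SymLamAt ρ A L y = 0 :=
  Finset.sum_eq_zero fun b hb => hA y b hb

/-- [folklore] **ON GAUGE-FIXED FIELDS THE TWO POINTS OF VIEW COINCIDE**: the symmetrised rooted averaging of a field in the symmetrised axial
gauge is `d!` times the straight block-contour sum [Balaban1984PropagatorsI] (1.11) (cf. `linAvgAt_eq_straightSum_of_axialGaugeAt`). -/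
theorem symLinAvgAt_eq_of_symAxialGaugeAt {ρ : Site d} {A : Form1 d ℝ} {L : ℕ} (hA : SymAxialGaugeAt ρ A L) (μ : Fin d) (y : Site d) :
    symLinAvgAt ρ A L μ y = (d ! : ℝ) * contourSum L A μ y := by
  rw [symLinAvgAt_eq_contourSum_sub_dz, dz, SymLamAt_eq_zero_of_symAxialGaugeAt hA, SymLamAt_eq_zero_of_symAxialGaugeAt hA, sub_zero,
    sub_zero]

/-- [folklore] **RIGIDITY**: if `A` and `A − grad λ` are both in the symmetrised axial gauge, `λ` is constant on every block (equal to its value at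
the root) — the sharp condition is a COMPLETE fixing of the residual gauge group `{λ : λ = 0 at the roots}`. -/
theorem symAxialGaugeAt_rigid {ρ : Site d} {A : Form1 d ℝ} {lam : Form0 d ℝ} {L : ℕ} (hA : SymAxialGaugeAt ρ A L)
    (hA' : SymAxialGaugeAt ρ (A - grad lam) L) (y : Site d) {b : Fin d → ℕ} (hb : b ∈ box d L) :
    lam ((L : ℤ) • y + toSite b) = lam ((L : ℤ) • y + ρ) := by
  have h := hA' y b hb
  rw [symAxial_sub, symAxial_grad, hA y b hb, zero_sub, neg_eq_zero, mul_eq_zero] at h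
  rcases h with h | h
  · exact absurd h factorial_ne_zero_real
  · exact sub_eq_zero.mp h

/-- [folklore] **ATTAINABILITY**: the projector lands in the symmetrised axial gauge, for every in-block root offset `ρ = toSite r`. -/
theorem symAxialGaugeAt_symAxProjAt {L : ℕ} {r : Fin d → ℕ} (hr : r ∈ box d L) (A : Form1 d ℝ) :
    SymAxialGaugeAt (toSite r) (symAxProjAt (toSite r) L A) L := by
  intro y b hb
  rw [symAxProjAt, symAxial_sub, symAxial_grad, ← symTreeGaugeAt_block r A y hb, ← mul_sub, ← mul_assoc, mul_inv_cancel₀ factorial_ne_zero_real,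
    one_mul, symTreeGaugeAt_root hr A y, sub_zero, sub_self]

/-- [folklore] The symmetrised tree gauge of a gauge-fixed field vanishes identically (`1 ≤ L`, in-block root). -/
theorem symTreeGaugeAt_eq_zero_of_symAxialGaugeAt {L : ℕ} (hL : 1 ≤ L) {r : Fin d → ℕ} {A : Form1 d ℝ}
    (hA : SymAxialGaugeAt (toSite r) A L) : symTreeGaugeAt (toSite r) A L = 0 := by
  funext x
  have h := hA (blk L x) (off L x) (off_mem_box hL x)
  rw [blk_add_off hL x] at h
  exact h

/-- [folklore] **IDEMPOTENCE** of the projector (`1 ≤ L`, in-block root offset). -/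
theorem symAxProjAt_idem {L : ℕ} (hL : 1 ≤ L) {r : Fin d → ℕ} (hr : r ∈ box d L) (A : Form1 d ℝ) :
    symAxProjAt (toSite r) L (symAxProjAt (toSite r) L A) = symAxProjAt (toSite r) L A := by
  conv_lhs => rw [symAxProjAt]
  rw [symTreeGaugeAt_eq_zero_of_symAxialGaugeAt hL (symAxialGaugeAt_symAxProjAt hr A)]
  funext κ x
  simp [grad]

/-- [folklore] The projector FIXES gauge-fixed fields (`1 ≤ L`, in-block root offset). -/
theorem symAxProjAt_eq_self_of_symAxialGaugeAt {L : ℕ} (hL : 1 ≤ L) {r : Fin d → ℕ} {A : Form1 d ℝ}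
    (hA : SymAxialGaugeAt (toSite r) A L) : symAxProjAt (toSite r) L A = A := by
  rw [symAxProjAt, symTreeGaugeAt_eq_zero_of_symAxialGaugeAt hL hA]
  funext κ x
  simp [grad]

/-- [folklore] THE SYMMETRISED AVERAGING IS BLIND TO THE PROJECTOR (in-block root): the subtracted gauge parameter vanishes at every root. -/
theorem symLinAvgAt_symAxProjAt {L : ℕ} {r : Fin d → ℕ} (hr : r ∈ box d L) (A : Form1 d ℝ) (μ : Fin d) (y : Site d) :
    symLinAvgAt (toSite r) (symAxProjAt (toSite r) L A) L μ y = symLinAvgAt (toSite r) A L μ y := by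
  have hroot : ∀ z : Site d, symTreeGaugeAt (toSite r) A L ((L : ℤ) • z + toSite r) = 0 := fun z => symTreeGaugeAt_root hr A z
  have hc : (L : ℤ) • y + toSite r + (L : ℤ) • unitVec μ = (L : ℤ) • (y + unitVec μ) + toSite r := by rw [smul_add]; abel
  rw [symAxProjAt, symLinAvgAt_gauge, hc, hroot, hroot, sub_self, mul_zero, sub_zero]

/-! ## §3 Permutation covariance of the projector at the centred root -/

/-- [folklore] `P1` is compatible with subtraction. -/
theorem P1_sub (π : Equiv.Perm (Fin d)) (A A' : Form1 d ℝ) : P1 π (A - A') = P1 π A - P1 π A' := rfl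

/-- [folklore] **THE SYMMETRISED AXIAL PROJECTOR COMMUTES WITH EVERY AXIS PERMUTATION** (centred root [Balaban1987RG1] (0.3) = `ctr`, all
coordinates equal): `symAxProjAt (ctr d L) L (P1 π A) = P1 π (symAxProjAt (ctr d L) L A)` — contrast the single comb (`CombPermutationWitness`). -/
theorem symAxProjAt_ctr_P1 (π : Equiv.Perm (Fin d)) (L : ℕ) (A : Form1 d ℝ) :
    symAxProjAt (ctr d L) L (P1 π A) = P1 π (symAxProjAt (ctr d L) L A) := by
  have hg : (fun x => (d ! : ℝ)⁻¹ * symTreeGaugeAt (ctr d L) (P1 π A) L x) = P0 π (fun x => (d ! : ℝ)⁻¹ * symTreeGaugeAt (ctr d L) A L x) := by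
    funext x
    rw [P0_apply, symTreeGaugeAt_ctr_P1]
  rw [symAxProjAt, symAxProjAt, P1_sub, hg, ← P1_grad]

/-- [folklore] At the centred root (`1 ≤ L`): attainability, by `ctrOff_mem_box`. -/
theorem symAxialGaugeAt_symAxProjAt_ctr {L : ℕ} (hL : 1 ≤ L) (A : Form1 d ℝ) :
    SymAxialGaugeAt (ctr d L) (symAxProjAt (ctr d L) L A) L :=
  symAxialGaugeAt_symAxProjAt (ctrOff_mem_box hL) A

/-- [folklore] **THE SLICE IS PERMUTATION-INVARIANT** at the centred root: `A` is gauge-fixed iff `P1 π A` is. -/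
theorem symAxialGaugeAt_ctr_P1 {L : ℕ} (π : Equiv.Perm (Fin d)) {A : Form1 d ℝ} (hA : SymAxialGaugeAt (ctr d L) A L) :
    SymAxialGaugeAt (ctr d L) (P1 π A) L := by
  intro y b hb
  rw [symAxial_P1, KernelPermutation.psite_add, KernelPermutation.psite_add, KernelPermutation.psite_smul, psite_ctr,
    ← ResolventPermutation.toSite_psite]
  exact hA _ _ (ResolventPermutation.psite_mem_box π hb)

end

end Summit.QuantumFields.BalabanUV.Beta.SymmetrisedAxialGauge
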